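import Summits.BirchSwinnertonDyer.BirchSwinnertonDyer.Theorems.SchneiderFreeAdditiveX3PoitouTatePresentationPairing
import Literature.NumberTheory.GaloisRepresentations.HomDualLocalPairingGlobal
import HarnessLib

/-!
# Poitou–Tate toolkit: (R4) of the presentation road from an E-side reciprocity sum in GLOBAL native terms
# (a global class `x ∈ H¹(K, M₀)`, the global connecting map `δ₁^K` of the presentation; no biduality inverse)

Cell `bsd-schneider-ideate`, seat `bsd-schneider-door-c6` (prover, generation 17).  PARTITION: board row
B6 ∩ X3 ∩ sst-twist, `r = 1`, of `Rank1Residual.partition` — CONTROL corner (crux `AnticycControlAdditiveK`,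
stmt-BirchSwinnertonDyer-19295; facts binder `ControlFacts` (i) = `poitouTate_selmerStructure_duality K`).
bears_on: K1-door (r1, B6∩X3-sst) (route-BirchSwinnertonDyer-SchneiderFreeAdditiveX3 item 18969).  THEOREMS ONLY;
closes nothing by itself (BSD is not advanced; no case of Poitou–Tate is proved here).

Sequel to `…PoitouTatePresentationPairing` (`hR4_of_localTerms`: (R4) ⟸ an E-side reciprocity sum whose finite local
terms are `− inv_{K_v}((π_v ∘ f)_* δ₁^{K_v}(H¹(κ)(loc_v y)))` for a class `y ∈ H¹(K, M₀^{DD})` and an inverse-of-biduality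
`κ`) and `HomDualLocalPairingGlobal` (`res ∘ δ₁ = δ₁ ∘ res`, `H¹(κ)(res (H¹(ι) x)) = res x`).  Here the E-side statement is
put in the form Milne's computation (ADT I, p. 58) actually produces it: the representative of `ŷ` is a class
**`x ∈ H¹(K, M₀)` of `M₀` itself** (intended: `infOneLayer y₀` for `ŷ = Inf_E y₀`), the dual-side class is `H¹(ι) x`
(`ι : M₀ → M₀^{DD}` the biduality map, `ι m f = f m`), and the finite local terms are
**`− inv_{K_v}((π_v ∘ f)_* (res_v (δ₁^K x)))`** with the GLOBAL native connecting map `δ₁^K : H¹(K, M₀) → H²(K, N₁)` of the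
canonical presentation (`FreePresentation.pres_isSES ρ₀`):

* **`hR4_of_globalTerms`** — (R4) for the readout, from that statement (for one biduality pair `(ι, κ)`);
* **`poitouTate_selmerStructure_duality_of_globalTerms`** — hE from {`TateDualityHypotheses (classBarD K) inv`, an idèle
  projection family with the ASSEMBLY property, the E-side reciprocity sum in global terms (for every `ι` with
  `ι m f = f m`)}.  The infinite places still enter as `(1/n)·⟨R_w f, loc_w (H¹(ι) x)⟩_w` (no native archimedean
  dictionary in the tree).

References: [MilneADT2006] I Thm. 4.10 (b) (proof, p. 58), Lemma 4.13, Prop. 0.19; [CasselsFrohlichANT1967] Ch. VII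
§11.2 (bis); [NeukirchSchmidtWingberg2008] (1.4.2)–(1.5.2).
-/

noncomputable section

open Function NumberField IsDedekindDomain CategoryTheory CategoryTheory.Abelian
open scoped NumberField ContRepresentation

set_option linter.dupNamespace false
set_option autoImplicit false

namespace Summit.BirchSwinnertonDyer.BirchSwinnertonDyer.Theorems.SchneiderFreeAdditiveX3.PoitouTateReduction

open Field
open Literature.NumberTheory.GaloisRepresentations Literature.NumberTheory.GaloisCohomology
open Literature.NumberTheory.GaloisRepresentations.DiscreteGaloisModule (mu TateDual tateDual
  localTatePairingZMod unramifiedSubgroup)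
open Literature.Algebra.Homology Literature.Algebra.Homology.DiscreteRep Literature.Algebra.Homology.ExtPresentation
open Literature.NumberTheory.GaloisRepresentations.IdeleClassBar (classBarD)
open Literature.NumberTheory.GaloisRepresentations.FreePresentation (presentationComplex presentationComplex_shortExact
  presModule₁ presModule₂ presIncl presProj pres_isSES moduleFinite_presModule₁ moduleFinite_presModule₂)
open Literature.NumberTheory.GaloisRepresentations.HomDual (IdeleProjection readout readoutInvariant localReadout
  readout_eq_localReadout charZero_of_algebra equivariantMap restrictIntertwining isSES_restrict
  zmodToQmodZ_localTatePairingZMod_localReadout map_map_res_eq_res res_δ₁_presentation)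
open Literature.NumberTheory.GaloisRepresentations.DGMBridge (LCarrier)
open Literature.AnabelianGeometry.AbsoluteAnabelian.Prop121vii (zmodToQmodZ brauerInvariantEquiv)

variable {K : Type} [Field K] [NumberField K]
variable (inv : Abelian.Ext (triv (Γ := absoluteGaloisGroup K) ℤ) (classBarD K) 2 →+ AddCircle (1 : ℚ))

/-- `loc_v (H¹(ι) x)` is unramified where `loc_v x` is (`res ∘ H¹(ι) = H¹(ι|) ∘ res`, and restriction to `K_v^nr`
commutes with the change of coefficients). [cite: MilneADT2006, Ch. I §2 (unramified classes)] -/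
theorem localization_map_mem_unramifiedSubgroup_of_mem {M M' : Type}
    [AddCommGroup M] [TopologicalSpace M] [DiscreteTopology M]
    [AddCommGroup M'] [TopologicalSpace M'] [DiscreteTopology M']
    {ρ : DiscreteGaloisModule K M} {ρ' : DiscreteGaloisModule K M'}
    (ι : ρ.toContRepresentation →ⁱL ρ'.toContRepresentation) (v : HeightOneSpectrum (𝓞 K))
    {x : galoisCohomology ρ 1}
    (hx : galoisCohomology.localization ρ (Sum.inr v) 1 x ∈ unramifiedSubgroup (GaloisRep.toLocal v ρ) 1) :
    galoisCohomology.localization ρ' (Sum.inr v) 1 (galoisCohomology.map ι 1 x) ∈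
      unramifiedSubgroup (GaloisRep.toLocal v ρ') 1 := by
  change galoisCohomology.res ρ' (v.adicCompletion K) 1 (galoisCohomology.map ι 1 x) ∈
    unramifiedSubgroup (ρ'.restrictField (v.adicCompletion K)) 1
  have hx' := (DiscreteGaloisModule.mem_unramifiedSubgroup_iff _ _ _).1 hx
  rw [galoisCohomology.res_map_one]
  refine (DiscreteGaloisModule.mem_unramifiedSubgroup_iff _ _ _).2 ?_
  refine (galoisCohomology.res_map_one (IsNonarchimedeanLocalField.maxUnramified (v.adicCompletion K)) _ _).trans ?_
  have hx'' : galoisCohomology.res (ρ.restrictField (v.adicCompletion K))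
      (IsNonarchimedeanLocalField.maxUnramified (v.adicCompletion K)) 1
      (galoisCohomology.res ρ (v.adicCompletion K) 1 x) = 0 := hx'
  rw [hx'', map_zero]

/-- **(R4) for the readout from the E-side reciprocity sum in GLOBAL native terms** (a biduality pair `(ι, κ)` fixed).
[cite: MilneADT2006, Ch. I, Thm. 4.10(b) (proof, p. 58), Prop. 0.19][cite: CasselsFrohlichANT1967, Ch. VII §11.2 (bis)] -/
theorem hR4_of_globalTerms (π : ∀ v : Place K, IdeleProjection K v)
    {n : ℕ} [NeZero n] {M : Type} [AddCommGroup M] [TopologicalSpace M] [DiscreteTopology M] [Finite M]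
    [Finite (TateDual K M n)] (ρ₀ : DiscreteGaloisModule K M) (hM : ∀ m : M, n • m = 0)
    (ι : ρ₀.toContRepresentation →ⁱL ((ρ₀.tateDual n).tateDual n).toContRepresentation)
    (κ : ((ρ₀.tateDual n).tateDual n).toContRepresentation →ⁱL ρ₀.toContRepresentation)
    (hκι : ∀ m : M, κ (ι m) = m)
    (hκ : ∀ (Φ : TateDual K (TateDual K M n) n) (f : TateDual K M n), Φ f = f (κ Φ))
    (hE : ∀ (f : (presentationComplex ρ₀).X₁ ⟶ (ideleClassLimitShortComplex K).X₂)
      (ŷ : Abelian.Ext (triv (Γ := absoluteGaloisGroup K) ℤ) (presentationComplex ρ₀).X₃ 1) (T₀ : Finset (Place K)),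
      ∃ (x : galoisCohomology ρ₀ 1) (Tx : Finset (Place K)), T₀ ⊆ Tx ∧
        (∀ v : HeightOneSpectrum (𝓞 K), (Sum.inr v : Place K) ∉ Tx →
          galoisCohomology.localization ρ₀ (Sum.inr v) 1 x ∈ unramifiedSubgroup (GaloisRep.toLocal v ρ₀) 1) ∧
        ∀ T' : Finset (Place K), Tx ⊆ T' →
          inv (ŷ.comp (boundary (presentationComplex_shortExact ρ₀) (classBarD K)
            (f ≫ (ideleClassLimitShortComplex K).g)) (rfl : 1 + 1 = 2)) =
          ∑ v ∈ T', Sum.elim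
            (fun w : InfinitePlace K => zmodToQmodZ n
              (localTatePairingZMod (ρ₀.tateDual n) n (Sum.inl w) (LocalInvariants.canonical K n (Sum.inl w))
                (readout ρ₀ n hM (π (Sum.inl w)) f)
                (galoisCohomology.localization ((ρ₀.tateDual n).tateDual n) (Sum.inl w) 1
                  (galoisCohomology.map ι 1 x))))
            (fun v : HeightOneSpectrum (𝓞 K) =>
              haveI := moduleFinite_presModule₁ ρ₀
              haveI : CharZero (v.adicCompletion K) := charZero_of_algebra (K := K) (v.adicCompletion K);
              - brauerInvariantEquiv (v.adicCompletion K)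
                (cohomologyMap (toTopRepHom ((presModule₁ ρ₀).restrictField (v.adicCompletion K))
                    (DiscreteGaloisModule.units (v.adicCompletion K))
                    (equivariantMap ((presModule₁ ρ₀).restrictField (v.adicCompletion K))
                      (DiscreteGaloisModule.units (v.adicCompletion K))
                      (readoutInvariant (π (Sum.inr v)) (presentationComplex ρ₀).X₁ f))) 2
                  (galoisCohomology.res (presModule₁ ρ₀) (v.adicCompletion K) 2 ((pres_isSES ρ₀).δ₁ x))))
            v) :
    ∀ (f : (presentationComplex ρ₀).X₁ ⟶ (ideleClassLimitShortComplex K).X₂)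
      (ŷ : Abelian.Ext (triv (Γ := absoluteGaloisGroup K) ℤ) (presentationComplex ρ₀).X₃ 1) (T₀ : Finset (Place K)),
      ∃ (y : galoisCohomology ((ρ₀.tateDual n).tateDual n) 1) (Ty : Finset (Place K)), T₀ ⊆ Ty ∧
        (∀ v : HeightOneSpectrum (𝓞 K), (Sum.inr v : Place K) ∉ Ty →
          galoisCohomology.localization ((ρ₀.tateDual n).tateDual n) (Sum.inr v) 1 y ∈
            unramifiedSubgroup (GaloisRep.toLocal v ((ρ₀.tateDual n).tateDual n)) 1) ∧
        ((∀ T' : Finset (Place K), Ty ⊆ T' →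
            ∑ v ∈ T', localTatePairingZMod (ρ₀.tateDual n) n v (LocalInvariants.canonical K n v)
              (readout ρ₀ n hM (π v) f)
              (galoisCohomology.localization ((ρ₀.tateDual n).tateDual n) v 1 y) = 0) →
          inv (ŷ.comp (boundary (presentationComplex_shortExact ρ₀) (classBarD K)
            (f ≫ (ideleClassLimitShortComplex K).g)) (rfl : 1 + 1 = 2)) = 0) := by
  haveI := moduleFinite_presModule₁ ρ₀
  haveI := moduleFinite_presModule₂ ρ₀
  refine hR4_of_localTerms inv π ρ₀ hM κ hκ fun f ŷ T₀ => ?_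
  obtain ⟨x, Tx, hT, hunr, hsum⟩ := hE f ŷ T₀
  refine ⟨galoisCohomology.map ι 1 x, Tx, hT, fun v hv => localization_map_mem_unramifiedSubgroup_of_mem ι v (hunr v hv),
    fun T' hT' => ?_⟩
  rw [hsum T' hT']
  refine Finset.sum_congr rfl ?_
  rintro (w | v) -
  · rfl
  · haveI : CharZero (v.adicCompletion K) := charZero_of_algebra (K := K) (v.adicCompletion K)
    change -(brauerInvariantEquiv (v.adicCompletion K) _) = -(brauerInvariantEquiv (v.adicCompletion K) _)
    congr 3
    change galoisCohomology.res (presModule₁ ρ₀) (v.adicCompletion K) 2 ((pres_isSES ρ₀).δ₁ x) =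
      (isSES_restrict (presModule₁ ρ₀) (presModule₂ ρ₀) ρ₀ (pres_isSES ρ₀) (K' := v.adicCompletion K)).δ₁
        (galoisCohomology.map (κ.restrictField (v.adicCompletion K)) 1
          (galoisCohomology.res ((ρ₀.tateDual n).tateDual n) (v.adicCompletion K) 1 (galoisCohomology.map ι 1 x)))
    rw [map_map_res_eq_res ρ₀ ι κ hκι, res_δ₁_presentation ρ₀ (v.adicCompletion K) x]

/-- **THE NAMED FACT `hE` from: Tate duality for `(Γ_K, C̄, inv)`, an idèle projection family with the ASSEMBLY property,
and the E-side reciprocity sum in GLOBAL native terms** (for every biduality map `ι` with `ι m f = f m`; the pair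
`(ι, κ)` used internally comes from `exists_bidual_intertwining`).  HONEST FRAMING: a reduction; the assembly and the
reciprocity sum are genuine remaining inputs; the infinite places enter untranslated.
[cite: MilneADT2006, Ch. I, Thm. 4.10(b) (proof, p. 58), Lemma 4.13, Thm. 1.8][cite: CasselsFrohlichANT1967, Ch. VII §11.2 (bis)] -/
theorem poitouTate_selmerStructure_duality_of_globalTerms
    (hT : TateDualityHypotheses (classBarD K) inv) (π : ∀ v : Place K, IdeleProjection K v)
    (hAsm : ∀ (n : ℕ) [NeZero n],
      ∀ ⦃M : Type⦄ [AddCommGroup M] [TopologicalSpace M] [DiscreteTopology M] [Finite M] [Finite (TateDual K M n)]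
      (ρ₀ : DiscreteGaloisModule K M) (_hM : ∀ m : M, n • m = 0),
      ∀ (T : Finset (Place K))
        (h : ∀ v : Place K, (haveI := moduleFinite_presModule₁ ρ₀
          (homGaloisModule ((presModule₁ ρ₀).restrictField (Place.Completion v))
            (DiscreteGaloisModule.units (Place.Completion v))).toTopRep.ρ.invariants)),
        (∀ v : HeightOneSpectrum (𝓞 K), (Sum.inr v : Place K) ∉ T → ∀ x : LCarrier (presentationComplex ρ₀).X₁,
          IsNonarchimedeanLocalField.ordQ (v.adicCompletion K)
            ((show LCarrier (presentationComplex ρ₀).X₁ →ₗ[ℤ] DiscreteGaloisModule.UnitsCarrier (v.adicCompletion K) from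
              ((h (Sum.inr v)).1 : DiscreteRep.HomCarrier (LCarrier (presentationComplex ρ₀).X₁)
                (DiscreteGaloisModule.UnitsCarrier (v.adicCompletion K)))) x) = 0) →
        ∃ f : (presentationComplex ρ₀).X₁ ⟶ (ideleClassLimitShortComplex K).X₂, ∀ v : Place K,
          (haveI := moduleFinite_presModule₁ ρ₀; readoutInvariant (π v) (presentationComplex ρ₀).X₁ f) = h v)
    (hE : ∀ (n : ℕ) [NeZero n],
      ∀ ⦃M : Type⦄ [AddCommGroup M] [TopologicalSpace M] [DiscreteTopology M] [Finite M] [Finite (TateDual K M n)]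
      (ρ₀ : DiscreteGaloisModule K M) (hM : ∀ m : M, n • m = 0)
      (ι : ρ₀.toContRepresentation →ⁱL ((ρ₀.tateDual n).tateDual n).toContRepresentation),
      (∀ (m : M) (f : TateDual K M n), ι m f = f m) →
      ∀ (f : (presentationComplex ρ₀).X₁ ⟶ (ideleClassLimitShortComplex K).X₂)
        (ŷ : Abelian.Ext (triv (Γ := absoluteGaloisGroup K) ℤ) (presentationComplex ρ₀).X₃ 1) (T₀ : Finset (Place K)),
        ∃ (x : galoisCohomology ρ₀ 1) (Tx : Finset (Place K)), T₀ ⊆ Tx ∧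
          (∀ v : HeightOneSpectrum (𝓞 K), (Sum.inr v : Place K) ∉ Tx →
            galoisCohomology.localization ρ₀ (Sum.inr v) 1 x ∈ unramifiedSubgroup (GaloisRep.toLocal v ρ₀) 1) ∧
          ∀ T' : Finset (Place K), Tx ⊆ T' →
            inv (ŷ.comp (boundary (presentationComplex_shortExact ρ₀) (classBarD K)
              (f ≫ (ideleClassLimitShortComplex K).g)) (rfl : 1 + 1 = 2)) =
            ∑ v ∈ T', Sum.elim
              (fun w : InfinitePlace K => zmodToQmodZ n
                (localTatePairingZMod (ρ₀.tateDual n) n (Sum.inl w) (LocalInvariants.canonical K n (Sum.inl w))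
                  (readout ρ₀ n hM (π (Sum.inl w)) f)
                  (galoisCohomology.localization ((ρ₀.tateDual n).tateDual n) (Sum.inl w) 1
                    (galoisCohomology.map ι 1 x))))
              (fun v : HeightOneSpectrum (𝓞 K) =>
                haveI := moduleFinite_presModule₁ ρ₀
                haveI : CharZero (v.adicCompletion K) := charZero_of_algebra (K := K) (v.adicCompletion K);
                - brauerInvariantEquiv (v.adicCompletion K)
                  (cohomologyMap (toTopRepHom ((presModule₁ ρ₀).restrictField (v.adicCompletion K))
                      (DiscreteGaloisModule.units (v.adicCompletion K))
                      (equivariantMap ((presModule₁ ρ₀).restrictField (v.adicCompletion K))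
                        (DiscreteGaloisModule.units (v.adicCompletion K))
                        (readoutInvariant (π (Sum.inr v)) (presentationComplex ρ₀).X₁ f))) 2
                    (galoisCohomology.res (presModule₁ ρ₀) (v.adicCompletion K) 2 ((pres_isSES ρ₀).δ₁ x))))
              v) :
    poitouTate_selmerStructure_duality K := by
  refine poitouTate_selmerStructure_duality_of_assembly inv hT π hAsm fun n _ M _ _ _ _ _ ρ₀ hM => ?_
  obtain ⟨ι, κ, hι, hκι, hικ⟩ := exists_bidual_intertwining (n := n) ρ₀ hM
  have hκ : ∀ (Φ : TateDual K (TateDual K M n) n) (f : TateDual K M n), Φ f = f (κ Φ) := fun Φ f => by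
    conv_lhs => rw [← hικ Φ]
    exact hι (κ Φ) f
  exact hR4_of_globalTerms inv π ρ₀ hM ι κ hκι hκ (hE n ρ₀ hM ι hι)

end Summit.BirchSwinnertonDyer.BirchSwinnertonDyer.Theorems.SchneiderFreeAdditiveX3.PoitouTateReduction

end
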